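import Literature.Computability.QuantumComplexity.PauliPathL2Window
import HarnessLib

/-!
# The path-ℓ₁ mass of Hamming-weight truncation: an all-rates accuracy window and the necessity of
# exponential Pauli-1-norm (magic) growth for the González-García–Cirac–Trivedi witness class

Topic `Literature/Computability/QuantumComplexity` (cell `qa-dq`, D-0154; census row DQ-N7, third currency beside
`PauliPathL2Window` (ℓ²-window, frame orbit); line L-cand-65 `truncation-l1-mass-necessity`, lens `barrier`).
The catalogued barrier `Literature.Barriers.QuantumAdvantage.pauliPathTruncation_worstCase` (GGCT 2025 Lemma 6 (v) /
Theorem 3; proved in tree, `pauliPathTruncation_worstCase_holds`): Hamming-weight truncation `⟨O⟩_ℓ = truncValue γ ℓ`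
of the noisy Pauli path integral has WORST-CASE error `≥ ((3/2)(1−γ)²)^k − 1` on an explicit Clifford+T family for
every rate `γ < 1 − √(2/3)`, `2k < ℓ ≤ 9k/4`.  Its technique class is truncation analysed by a COUNT of surviving paths
times the unitarity bound `|f(s)| ≤ 1` (the printed positive side, their Theorem 1 = tree `PauliPathL2Window`, is the
same count `N_w ≤ 2^{Qw}`).  This file types a third currency: the **path-ℓ₁ mass** `Λ := Σ_s |f(C,s)|` (`pathL1Mass`,
rate-`0` coefficients of the tree's `PauliPath.pathCoeff`), its tail `Λ_{>ℓ}` (`tailL1Mass`), and the **operator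
Pauli 1-norm** `‖A‖_{P,1} := 2^{−n} Σ_S |Tr(A S)|` (`pauliL1`) whose per-layer expansion `‖U_t† T U_t‖_{P,1} ≤ m_t`
enters only as a hypothesis.

* R1 `L1MassTail` (proved): `|⟨O⟩_err − ⟨O⟩_ℓ| ≤ (1−γ)^{ℓ+1} Λ_{>ℓ} ≤ (1−γ)^{ℓ+1} Λ` for EVERY real rate `0 ≤ γ ≤ 1`,
  every circuit (unitarity not needed), input, observable — no threshold, no average (tree `noisyValue_sub_truncValue`,
  `pathCoeff_eq_pow_mul_pathCoeff_zero`);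
* R2 `PathL1Budget` (proved; induction on the depth peeling the last layer with the tree's `pathCoeff_snoc` — the ℓ₁
  twin of `PauliPathL2Window.sum_norm_sq_pathCoeff_zero_le`, which is cited, not restated):
  `(∀ S, |Tr(Sρ)| ≤ c) → (∀ t T, ‖U_t† T U_t‖_{P,1} ≤ m_t) → Λ ≤ c · (Π_t m_t) · ‖O‖_{P,1}`; density-matrix inputs
  have `c = 1` by `PauliPathL2Window.normSq_trace_pauliString_mul_le_one` (L-06 `StateBound`, by name);
* R3 `CliffordLayersFree` (proved): a Pauli-MONOMIAL layer (every Clifford) has expansion `≤ 1`; a Pauli rotation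
  `R_G(θ)` has expansion `≤ |cos θ| + |sin θ| ≤ √2` (tree `PauliPropagation.rotConj_pauliString_of_comm/_of_anticomm`);
* W `MagicBudgetWindow` (proved, R1 + R2): `|⟨O⟩_err − ⟨O⟩_ℓ| ≤ (1−γ)^{ℓ+1} · c · (Π_t m_t) · ‖O‖_{P,1}` at every rate;
* R4 `WitnessNeedsMass` (proved, the contrapositive): an instance with truncation error `≥ E` at `(γ, ℓ)` has
  `Λ_{>ℓ} ≥ E (1−γ)^{−(ℓ+1)}` and `Π_t m_t ≥ E / ((1−γ)^{ℓ+1} c ‖O‖_{P,1})`;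
* R5 `GGCTWitnessMass` (proved from the barrier theorem BY NAME, no block recomputation): on the catalogued witness
  `Λ_{>ℓ}(k) ≥ (((3/2)(1−p)²)^k − 1)/(1−p)^{ℓ+1}`, and `Λ(k) ≥ (3/2)^k − 1` for `k ≥ 4`.

BARRIER PLACEMENT.  This sits OUTSIDE the technique class of `pauliPathTruncation_worstCase` (which quantifies over all
circuits at a fixed rate) by restricting to the class {path-ℓ₁ mass `≤ M`} (e.g. `t` Pauli rotations among arbitrarily
many Clifford layers: `Π m_t ≤ 2^{t/2}`, an ACCURACY budget); it neither weakens nor contradicts the barrier, which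
stays a theorem; R4 says the barrier's witnesses necessarily carry mass `≥ E · (1−γ)^{−(ℓ+1)}`.

COST CAVEAT / MEANING.  These are ACCURACY bounds for the fixed estimator `truncValue γ ℓ` and a resource inequality
its hard instances satisfy.  The NUMBER of paths of weight `≤ ℓ` (the running-time side), algorithms, samplers and
running times are NOT typed; `Λ` itself may be expensive to evaluate; nothing here proves or refutes quantum advantage
(BQP vs BPP untouched).  IN PRINT (Rall et al. 2019, Pauli-propagation Monte Carlo): `pauliL1` IS their stabilizer
norm `𝒟(A)` (Def. 2.1); R2 = the path-sum form of their cost bound `𝒟(ρ₀)·Π_i 𝒟(Λ_i)·max_σ|Tr(σE)|` (§2.2); R3 = §3.4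
(Clifford PTM = signed permutation) and §3.5 (`𝒟(Λ_{1,θ}) = max(1, |cos θ|+|sin θ|)`).  Beyond print: R1/W, R4/R5.
Dedup: tree `PauliPropagation.norm_trace_sub_truncateTo_mul_le` (Rudolph et al. Box 3) is the ONE-operator,
coefficient-SET truncation bound `|Tr[(O − Π_K O)ρ]| ≤ 2^{-n} Σ_{S∉K} |a_S|`; here PATHS through `d` layers with
intermediate noise weights and Hamming-weight truncation.  Deliberately NOT here: coefficient (Top-K) truncation
(Shao–Cheng–Liu 2026, operator stabilizer Rényi entropy), average-case statements (tree `PauliPathOrthogonality`,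
`LowWeightPauliPropagation`), GGCT's rate comparison `Q` vs `p` (Theorems 1/3), the exact `Λ(k) = 2^k`.
-/


noncomputable section

open Matrix Finset

namespace Literature.Computability.QuantumComplexity

namespace PauliPathL1Mass

open PauliPath

variable {ι : Type*} [Fintype ι] [DecidableEq ι]

/-! ### §0 Helpers -/

omit [Fintype ι] [DecidableEq ι] in
/-- Sums over `1`-tuples are sums over the entry (plumbing). [folklore] -/
private theorem sum_fin_one {α β : Type*} [Fintype α] [AddCommMonoid β] (g : (Fin 1 → α) → β) :
    ∑ s, g s = ∑ a, g (fun _ => a) := by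
  refine Fintype.sum_equiv (Equiv.funUnique (Fin 1) α) _ _ (fun s => ?_)
  congr 1
  funext i
  simp [Fin.fin_one_eq_zero i]

omit [Fintype ι] [DecidableEq ι] in
/-- Sums over `(d+2)`-tuples are sums over (last entry, initial `(d+1)`-tuple) (plumbing). [folklore] -/
private theorem sum_fin_snoc {α β : Type*} [Fintype α] [AddCommMonoid β] {d : ℕ}
    (g : (Fin (d + 2) → α) → β) :
    ∑ s, g s = ∑ T : α, ∑ s' : Fin (d + 1) → α, g (Fin.snoc s' T) := by
  rw [← (Fin.snocEquiv fun _ => α).sum_comp, Fintype.sum_prod_type]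
  rfl

omit [DecidableEq ι] in
/-- `|sign_W(S)| = 1`. [folklore] -/
private theorem norm_strSign (W S : ι → Pauli) : ‖strSign W S‖ = 1 := by
  rcases OTOC.strSign_eq_one_or W S with h | h <;> simp [h]

/-! ### §1 The Pauli 1-norm `‖A‖_{P,1} = 2^{-n} Σ_S |Tr(A S)|` and the expansion of a layer -/

/-- The **operator Pauli 1-norm** `‖A‖_{P,1} := 2^{−n} Σ_S |Tr(A S)|` of a MATRIX on the register = the **stabilizer
norm** `𝒟(A)` of Rall et al. (Campbell's st-norm; the ℓ₁ norm of the normalised Pauli coefficients; `= 1` on a Pauli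
string; for `A = C† P C`, twice its logarithm is Shao–Cheng–Liu's operator stabilizer Rényi-½ entropy).  NOT the tree's
`GuidedPauliHamiltonian.pauliOneNorm` / `PauliSumFrobeniusResidue` 1-norms of Hamiltonian TERM LISTS (other object).
[cite: RallEtAl2019, Def. 2.1 (stabilizer norm D(A) = 2^{-n} Σ_σ |Tr(σA)|)] [cite: ShaoChengLiu2026PauliPropagationOperatorComplexity, §III Definition 1 eq. (9)] -/
def pauliL1 (A : Matrix (ι → Bool) (ι → Bool) ℂ) : ℝ :=
  ((2 : ℝ) ^ Fintype.card ι)⁻¹ * ∑ S : ι → Pauli, ‖(A * pauliString S).trace‖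

/-- `‖A‖_{P,1} ≥ 0` (a norm of the Pauli-coefficient vector). [cite: ShaoChengLiu2026PauliPropagationOperatorComplexity, §III Definition 1 (the normalised Pauli-coefficient vector c_i = 2^{-n} tr{P_i O})] -/
theorem pauliL1_nonneg (A : Matrix (ι → Bool) (ι → Bool) ℂ) : 0 ≤ pauliL1 A := by
  unfold pauliL1
  positivity

/-- `‖P‖_{P,1} = 1` for a Pauli string (trace orthogonality). [cite: KempeEtAl2010, §2 (Tr(SS') = 2ⁿ δ)] -/
theorem pauliL1_pauliString (T : ι → Pauli) : pauliL1 (pauliString T) = 1 := by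
  unfold pauliL1
  simp only [trace_pauliString_mul_pauliString]
  rw [Finset.sum_eq_single T]
  · rw [if_pos rfl, norm_pow, Complex.norm_ofNat]
    exact inv_mul_cancel₀ (pow_ne_zero _ two_ne_zero)
  · intro S _ hS
    rw [if_neg (Ne.symm hS), norm_zero]
  · intro h
    exact absurd (Finset.mem_univ T) h

/-- Homogeneity `‖c A‖_{P,1} = |c| ‖A‖_{P,1}` (ℓ₁ norm of the Pauli-coefficient vector). [cite: ShaoChengLiu2026PauliPropagationOperatorComplexity, §III Definition 1 (c_i = 2^{-n} tr{P_i O})] -/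
theorem pauliL1_smul (c : ℂ) (A : Matrix (ι → Bool) (ι → Bool) ℂ) : pauliL1 (c • A) = ‖c‖ * pauliL1 A := by
  unfold pauliL1
  simp only [Matrix.smul_mul, Matrix.trace_smul, smul_eq_mul, norm_mul, ← Finset.mul_sum]
  ring

/-- Subadditivity `‖A + B‖_{P,1} ≤ ‖A‖_{P,1} + ‖B‖_{P,1}` (ℓ₁ norm of the Pauli-coefficient vector). [cite: ShaoChengLiu2026PauliPropagationOperatorComplexity, §III Definition 1 (c_i = 2^{-n} tr{P_i O})] -/
theorem pauliL1_add_le (A B : Matrix (ι → Bool) (ι → Bool) ℂ) : pauliL1 (A + B) ≤ pauliL1 A + pauliL1 B := by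
  unfold pauliL1
  rw [← mul_add, ← Finset.sum_add_distrib]
  refine mul_le_mul_of_nonneg_left (Finset.sum_le_sum fun S _ => ?_) (by positivity)
  rw [Matrix.add_mul, Matrix.trace_add]
  exact norm_add_le _ _

/-- Subadditivity over finite sums (ℓ₁ norm of the Pauli-coefficient vector). [cite: ShaoChengLiu2026PauliPropagationOperatorComplexity, §III Definition 1 (c_i = 2^{-n} tr{P_i O})] -/
theorem pauliL1_sum_le {κ : Type*} (s : Finset κ) (A : κ → Matrix (ι → Bool) (ι → Bool) ℂ) :
    pauliL1 (∑ k ∈ s, A k) ≤ ∑ k ∈ s, pauliL1 (A k) := by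
  unfold pauliL1
  rw [← Finset.mul_sum, Finset.sum_comm]
  refine mul_le_mul_of_nonneg_left (Finset.sum_le_sum fun S _ => ?_) (by positivity)
  rw [Finset.sum_mul, Matrix.trace_sum]
  exact norm_sum_le _ _

/-- **Expansion of a layer controls the Pauli 1-norm of every conjugate**: if `‖V† T V‖_{P,1} ≤ m` for all Pauli
strings `T`, then `‖V† A V‖_{P,1} ≤ m ‖A‖_{P,1}` for every `A` (expand `A` in the Pauli basis, tree
`eq_inv_smul_sum_pauliCoeff_smul`).  The number `max_T ‖V† T V‖_{P,1}` is the per-gate ℓ₁ cost of `V` in Pauli-basis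
propagation (`1` for Cliffords) — Rall et al.'s channel stabilizer norm `𝒟(Λ_V) = max_σ 𝒟(V†σV)` and cost recursion.
[cite: RallEtAl2019, Def. 2.2 and the recursion/bound after it (§2.2)] [cite: ShaoChengLiu2026PauliPropagationOperatorComplexity, §III Lemma 1 (2)] -/
theorem pauliL1_conj_le {V A : Matrix (ι → Bool) (ι → Bool) ℂ} {m : ℝ}
    (hm : ∀ T : ι → Pauli, pauliL1 (Vᴴ * pauliString T * V) ≤ m) : pauliL1 (Vᴴ * A * V) ≤ m * pauliL1 A := by
  have hexp : Vᴴ * A * V =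
      ∑ T : ι → Pauli, (((2 : ℂ) ^ Fintype.card ι)⁻¹ * pauliCoeff A T) • (Vᴴ * pauliString T * V) := by
    conv_lhs => rw [eq_inv_smul_sum_pauliCoeff_smul A]
    rw [Matrix.mul_smul, Matrix.smul_mul, Matrix.mul_sum, Matrix.sum_mul, Finset.smul_sum]
    refine Finset.sum_congr rfl fun T _ => ?_
    rw [Matrix.mul_smul, Matrix.smul_mul, smul_smul]
  rw [hexp]
  refine (pauliL1_sum_le _ _).trans ?_
  calc ∑ T : ι → Pauli, pauliL1 ((((2 : ℂ) ^ Fintype.card ι)⁻¹ * pauliCoeff A T) • (Vᴴ * pauliString T * V))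
      = ∑ T : ι → Pauli, ((2 : ℝ) ^ Fintype.card ι)⁻¹ * ‖(A * pauliString T).trace‖ *
          pauliL1 (Vᴴ * pauliString T * V) := by
        refine Finset.sum_congr rfl fun T _ => ?_
        rw [pauliL1_smul, norm_mul, norm_inv, norm_pow, Complex.norm_ofNat, pauliCoeff_eq, Matrix.trace_mul_comm]
    _ ≤ ∑ T : ι → Pauli, ((2 : ℝ) ^ Fintype.card ι)⁻¹ * ‖(A * pauliString T).trace‖ * m :=
        Finset.sum_le_sum fun T _ => mul_le_mul_of_nonneg_left (hm T) (by positivity)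
    _ = m * pauliL1 A := by
        rw [pauliL1, Finset.mul_sum, Finset.mul_sum]
        exact Finset.sum_congr rfl fun T _ => by ring

/-! ### §2 Pauli-monomial (Clifford) layers are free; a Pauli rotation costs at most `|cos θ| + |sin θ| ≤ √2` -/

/-- A layer is **Pauli-monomial** if it conjugates every Pauli string to a sub-unit multiple of a Pauli string
(every Clifford unitary: phase `±1`; Pauli strings; the identity).  Stated as a plain predicate, no Clifford-group
structure is built. [cite: AharonovEtAl2023, §2 (proof of Lemma 2: V P V† = (−1)^{⟨V,P⟩} P for Pauli V)] -/
def IsPauliMonomialLayer (V : Matrix (ι → Bool) (ι → Bool) ℂ) : Prop :=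
  ∀ T : ι → Pauli, ∃ (T' : ι → Pauli) (c : ℂ), ‖c‖ ≤ 1 ∧ Vᴴ * pauliString T * V = c • pauliString T'

/-- **Clifford layers are free**: a Pauli-monomial layer has expansion `≤ 1`.
[cite: RallEtAl2019, §3.4 (the PTM of a Clifford gate is a signed permutation matrix; Prop. 3.9 D(Λ) = induced 1-norm of the PTM)] -/
theorem pauliL1_conj_le_one_of_monomial {V : Matrix (ι → Bool) (ι → Bool) ℂ} (hV : IsPauliMonomialLayer V)
    (T : ι → Pauli) : pauliL1 (Vᴴ * pauliString T * V) ≤ 1 := by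
  obtain ⟨T', c, hc, h⟩ := hV T
  rw [h, pauliL1_smul, pauliL1_pauliString, mul_one]
  exact hc

/-- A Pauli-string layer is Pauli-monomial (`W T W = sign_W(T) T`, tree `pauliString_conj_eq_strSign_smul`).
[cite: AharonovEtAl2023, §2 (proof of Lemma 2)] -/
theorem isPauliMonomialLayer_pauliString (W : ι → Pauli) : IsPauliMonomialLayer (pauliString W) := fun T =>
  ⟨T, strSign W T, (norm_strSign W T).le, by rw [conjTranspose_pauliString, pauliString_conj_eq_strSign_smul]⟩

/-- **A Pauli rotation costs at most `|cos θ| + |sin θ|`**: by the tree's branching rule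
(`rotConj_pauliString_of_comm`: `R_G(θ)[T] = T` if `[G,T] = 0`; `_of_anticomm`: `cos θ · T + i sin θ · GT` else),
`‖R_G(θ)† T R_G(θ)‖_{P,1} ∈ {1, |cos θ| + |sin θ|}` — Rall et al.'s `𝒟(Λ_{f,θ}) = max(1, f(|cos θ| + |sin θ|))` at `f = 1`.
[cite: RallEtAl2019, §3.5 (depolarized rotations, PTM R_θ)] [cite: RudolphEtAl2025, §II B eq. (14) (branching rule)] -/
theorem pauliL1_rotConj_pauliString_le (θ : ℝ) (G T : ι → Pauli) :
    pauliL1 ((PauliPropagation.pauliRot θ G)ᴴ * pauliString T * PauliPropagation.pauliRot θ G) ≤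
      |Real.cos θ| + |Real.sin θ| := by
  rw [← PauliPropagation.rotConj_eq]
  rcases OTOC.strSign_eq_one_or G T with h | h
  · rw [PauliPropagation.rotConj_pauliString_of_comm θ h, pauliL1_pauliString]
    have h1 : Real.cos θ ^ 2 ≤ |Real.cos θ| := by
      rw [← sq_abs]; nlinarith [abs_nonneg (Real.cos θ), Real.abs_cos_le_one θ]
    have h2 : Real.sin θ ^ 2 ≤ |Real.sin θ| := by
      rw [← sq_abs]; nlinarith [abs_nonneg (Real.sin θ), Real.abs_sin_le_one θ]
    nlinarith [Real.cos_sq_add_sin_sq θ]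
  · rw [PauliPropagation.rotConj_pauliString_of_anticomm θ h]
    have hsp : ‖stringPhase G T‖ = 1 := by
      rcases PauliPropagation.I_mul_stringPhase_eq_or h with h1 | h1 <;>
        · have h2 := congrArg norm h1
          simpa using h2
    refine (pauliL1_add_le _ _).trans ?_
    rw [pauliL1_smul, pauliL1_pauliString, mul_one, Complex.norm_real, Real.norm_eq_abs, pauliL1_smul, norm_mul,
      Complex.norm_I, one_mul, Complex.norm_real, Real.norm_eq_abs, pauliString_mul, pauliL1_smul, hsp, one_mul,
      pauliL1_pauliString, mul_one]

omit [Fintype ι] [DecidableEq ι] in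
/-- `|cos θ| + |sin θ| ≤ √2` (so `t` rotations cost at most `2^{t/2}`; the T gate `θ = π/4` attains it).
[cite: RallEtAl2019, §3.5 (the boundary |cos θ| + |sin θ| = 1 «forms a diamond»; depolarized T)] -/
theorem abs_cos_add_abs_sin_le_sqrt_two (θ : ℝ) : |Real.cos θ| + |Real.sin θ| ≤ Real.sqrt 2 := by
  refine Real.le_sqrt_of_sq_le ?_
  nlinarith [Real.cos_sq_add_sin_sq θ, sq_abs (Real.cos θ), sq_abs (Real.sin θ),
    sq_nonneg (|Real.cos θ| - |Real.sin θ|)]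

/-- (R3, record) **Clifford layers are free, rotations cost ≤ √2**: the expansion hypothesis of R2 with `m_t = 1` on
Pauli-monomial layers and `m_t = |cos θ_t| + |sin θ_t|` on Pauli-rotation layers.
[cite: RallEtAl2019, §3.4 (Clifford PTM signed permutation), §3.5 (D(Λ_{f,θ}) = max(1, f(|cos θ|+|sin θ|)))] -/
def CliffordLayersFree : Prop :=
  ∀ {ι : Type} [Fintype ι] [DecidableEq ι],
    (∀ (V : Matrix (ι → Bool) (ι → Bool) ℂ) (_hV : IsPauliMonomialLayer V) (T : ι → Pauli),
        pauliL1 (Vᴴ * pauliString T * V) ≤ 1) ∧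
      ∀ (θ : ℝ) (G T : ι → Pauli),
        pauliL1 ((PauliPropagation.pauliRot θ G)ᴴ * pauliString T * PauliPropagation.pauliRot θ G) ≤
          |Real.cos θ| + |Real.sin θ|

/-- R3 holds. [cite: RallEtAl2019, §3.4–§3.5] -/
theorem cliffordLayersFree_holds : CliffordLayersFree :=
  ⟨fun _ hV T => pauliL1_conj_le_one_of_monomial hV T, fun θ G T => pauliL1_rotConj_pauliString_le θ G T⟩

/-- `CliffordLayersFree` — `_holds` alias of `cliffordLayersFree_holds` above under the fact's exact name (appended
2026-08-28, D-0026 bookkeeping: the proof term is the existing theorem of this file; no statement,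
definition or attribute is edited; no new named fact; the ledger's debt table listed the fact
unproved). [cite: RallEtAl2019, §3.4–§3.5] -/
theorem _root_.Literature.Computability.QuantumComplexity.PauliPathL1Mass.CliffordLayersFree_holds :
    CliffordLayersFree :=
  _root_.Literature.Computability.QuantumComplexity.PauliPathL1Mass.cliffordLayersFree_holds

/-! ### §3 The path-ℓ₁ mass and Record R1 — the all-rates tail bound -/

/-- The **path-ℓ₁ mass** `Λ(U,ρ,O) := Σ_s |f(s)|` of the (rate-`0`) Pauli path integral — the coefficient-weighted
replacement for GGCT's count `N_w` with `|f(s)| ≤ 1`.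
[cite: GonzalezGarciaCiracTrivedi2025PauliPathBeyondAverageQuantum, §3 (f(s); 'the sum Σ_{|s|=w} f(s) can be exponentially large') and proof of Theorem 1 (|f(s)| ≤ 1 ∀ s from unitarity)] -/
def pathL1Mass {d : ℕ} (U : Fin d → Matrix (ι → Bool) (ι → Bool) ℂ) (ρ O : Matrix (ι → Bool) (ι → Bool) ℂ) : ℝ :=
  ∑ s : Fin (d + 1) → ι → Pauli, ‖pathCoeff 0 U ρ O s‖

/-- The **tail mass** `Λ_{>ℓ} := Σ_{|s| > ℓ} |f(s)|` — the mass the weight-`ℓ` estimator drops.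
[cite: GonzalezGarciaCiracTrivedi2025PauliPathBeyondAverageQuantum, §3 (⟨O⟩_ℓ drops paths of weight > ℓ)] -/
def tailL1Mass (ℓ : ℕ) {d : ℕ} (U : Fin d → Matrix (ι → Bool) (ι → Bool) ℂ)
    (ρ O : Matrix (ι → Bool) (ι → Bool) ℂ) : ℝ :=
  ∑ s ∈ Finset.univ.filter (fun s : Fin (d + 1) → ι → Pauli => ¬ pathWeight s ≤ ℓ), ‖pathCoeff 0 U ρ O s‖

/-- `Λ_{>ℓ} ≤ Λ` (the dropped paths are a subset of all paths). [cite: GonzalezGarciaCiracTrivedi2025PauliPathBeyondAverageQuantum, §3 (⟨O⟩_ℓ keeps the paths of weight ≤ ℓ)] -/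
theorem tailL1Mass_le_pathL1Mass (ℓ : ℕ) {d : ℕ} (U : Fin d → Matrix (ι → Bool) (ι → Bool) ℂ)
    (ρ O : Matrix (ι → Bool) (ι → Bool) ℂ) : tailL1Mass ℓ U ρ O ≤ pathL1Mass U ρ O :=
  Finset.sum_le_sum_of_subset_of_nonneg (Finset.filter_subset _ _) fun _ _ _ => norm_nonneg _

/-- **The all-rates ℓ₁ tail bound**: `|⟨O⟩_err − ⟨O⟩_ℓ| ≤ (1−γ)^{ℓ+1} Λ_{>ℓ}` for every real rate `0 ≤ γ ≤ 1`, every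
circuit (no unitarity needed), input and observable: each dropped path has `|f_γ(s)| = (1−γ)^{|s|} |f_0(s)|`
(tree `pathCoeff_eq_pow_mul_pathCoeff_zero`) with `|s| ≥ ℓ + 1`.  No threshold on `γ`.
[cite: GonzalezGarciaCiracTrivedi2025PauliPathBeyondAverageQuantum, §3 (|⟨O⟩_err − ⟨O⟩_ℓ| bounded path by path) and proof of Theorem 1] -/
theorem norm_noisyValue_sub_truncValue_le_tailL1Mass (γ : ℝ) (hγ0 : 0 ≤ γ) (hγ1 : γ ≤ 1) (ℓ : ℕ) {d : ℕ}
    (U : Fin d → Matrix (ι → Bool) (ι → Bool) ℂ) (ρ O : Matrix (ι → Bool) (ι → Bool) ℂ) :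
    ‖noisyValue (γ : ℂ) U ρ O - truncValue (γ : ℂ) ℓ U ρ O‖ ≤ (1 - γ) ^ (ℓ + 1) * tailL1Mass ℓ U ρ O := by
  rw [noisyValue_sub_truncValue, tailL1Mass, Finset.mul_sum]
  refine (norm_sum_le _ _).trans (Finset.sum_le_sum fun s hs => ?_)
  have hw : ℓ + 1 ≤ pathWeight s := Nat.succ_le_of_lt (not_le.mp (Finset.mem_filter.mp hs).2)
  have h1 : ‖(1 - (γ : ℂ))‖ = 1 - γ := by
    rw [← Complex.ofReal_one, ← Complex.ofReal_sub, Complex.norm_real, Real.norm_eq_abs,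
      abs_of_nonneg (by linarith)]
  rw [pathCoeff_eq_pow_mul_pathCoeff_zero, norm_mul, norm_pow, h1]
  exact mul_le_mul_of_nonneg_right (pow_le_pow_of_le_one (by linarith) (by linarith) hw) (norm_nonneg _)

/-- (R1, record) **ℓ₁ tail**: for every real `0 ≤ γ ≤ 1`, every `ℓ`, circuit, input, observable,
`|⟨O⟩_err − ⟨O⟩_ℓ| ≤ (1−γ)^{ℓ+1} Λ_{>ℓ} ≤ (1−γ)^{ℓ+1} Λ`.
[cite: GonzalezGarciaCiracTrivedi2025PauliPathBeyondAverageQuantum, §3 and proof of Theorem 1 (error ≤ Σ_{w>ℓ} (1−p)^w Σ|f(s)|)] -/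
def L1MassTail : Prop :=
  ∀ {ι : Type} [Fintype ι] [DecidableEq ι] (γ : ℝ) (_hγ0 : 0 ≤ γ) (_hγ1 : γ ≤ 1) (ℓ : ℕ) {d : ℕ}
    (U : Fin d → Matrix (ι → Bool) (ι → Bool) ℂ) (ρ O : Matrix (ι → Bool) (ι → Bool) ℂ),
    ‖noisyValue (γ : ℂ) U ρ O - truncValue (γ : ℂ) ℓ U ρ O‖ ≤ (1 - γ) ^ (ℓ + 1) * tailL1Mass ℓ U ρ O ∧
      (1 - γ) ^ (ℓ + 1) * tailL1Mass ℓ U ρ O ≤ (1 - γ) ^ (ℓ + 1) * pathL1Mass U ρ O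

/-- R1 holds. [cite: GonzalezGarciaCiracTrivedi2025PauliPathBeyondAverageQuantum, §3 and proof of Theorem 1] -/
theorem l1MassTail_holds : L1MassTail := fun γ hγ0 hγ1 ℓ _ U ρ O =>
  ⟨norm_noisyValue_sub_truncValue_le_tailL1Mass γ hγ0 hγ1 ℓ U ρ O,
    mul_le_mul_of_nonneg_left (tailL1Mass_le_pathL1Mass ℓ U ρ O) (pow_nonneg (by linarith) _)⟩

/-- `L1MassTail` — `_holds` alias of `l1MassTail_holds` above under the fact's exact name (appended
2026-08-28, D-0026 bookkeeping: the proof term is the existing theorem of this file; no statement,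
definition or attribute is edited; no new named fact; the ledger's debt table listed the fact
unproved). [cite: GonzalezGarciaCiracTrivedi2025PauliPathBeyondAverageQuantum, §3 and proof of Theorem 1] -/
theorem _root_.Literature.Computability.QuantumComplexity.PauliPathL1Mass.L1MassTail_holds :
    L1MassTail :=
  _root_.Literature.Computability.QuantumComplexity.PauliPathL1Mass.l1MassTail_holds

/-! ### §4 Record R2 — the layer budget for the path-ℓ₁ mass (proved) -/

/-- **The layer budget**: `Λ ≤ c · (Π_t m_t) · ‖O‖_{P,1}` whenever the input brackets are bounded by `c` and layer `t`
expands Pauli 1-norms by at most `m_t` — induction on the depth, peeling the last layer with the tree's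
`pathCoeff_snoc` (the last layer turns the read-out `O` into the brackets `2^{-n} Tr(O T)` against the conjugates
`U_d† T U_d`, budgeted by `pauliL1_conj_le`).  Unitarity is not used.  = the PATH-SUM form of Rall et al.'s range bound
`|ĉ_k Tr(σ̂_k E)| ≤ 𝒟(ρ₀)·Π_i 𝒟(Λ_i)·max_σ|Tr(σE)|`. [cite: RallEtAl2019, §2.2 (bound after Def. 2.2)] [cite: GonzalezGarciaCiracTrivedi2025PauliPathBeyondAverageQuantum, proof of Theorem 1 (|f(s)| ≤ 1 and the count N_w ≤ 2^{Qw}: here both replaced by the ℓ₁ mass)] -/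
theorem pathL1Mass_le_budget :
    ∀ (d : ℕ) (U : Fin d → Matrix (ι → Bool) (ι → Bool) ℂ) (ρ O : Matrix (ι → Bool) (ι → Bool) ℂ) (c : ℝ)
      (m : Fin d → ℝ) (_hρ : ∀ S : ι → Pauli, ‖(pauliString S * ρ).trace‖ ≤ c)
      (_hm : ∀ (t : Fin d) (T : ι → Pauli), pauliL1 ((U t)ᴴ * pauliString T * U t) ≤ m t),
      pathL1Mass U ρ O ≤ c * (∏ t, m t) * pauliL1 O := by
  intro d
  induction d with
  | zero =>
    intro U ρ O c m hρ _hm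
    unfold pathL1Mass
    calc ∑ s : Fin (0 + 1) → ι → Pauli, ‖pathCoeff 0 U ρ O s‖
        = ∑ S : ι → Pauli, ((2 : ℝ) ^ Fintype.card ι)⁻¹ *
            (‖(O * pauliString S).trace‖ * ‖(pauliString S * ρ).trace‖) := by
          rw [sum_fin_one]
          refine Finset.sum_congr rfl fun S _ => ?_
          simp only [pathCoeff, depolarizeAll_rate_zero, Fin.prod_univ_zero, mul_one, zero_add, pow_one,
            norm_mul, norm_inv, norm_pow, Complex.norm_ofNat]
      _ ≤ ∑ S : ι → Pauli, ((2 : ℝ) ^ Fintype.card ι)⁻¹ * (‖(O * pauliString S).trace‖ * c) :=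
          Finset.sum_le_sum fun S _ =>
            mul_le_mul_of_nonneg_left (mul_le_mul_of_nonneg_left (hρ S) (norm_nonneg _)) (by positivity)
      _ = c * (∏ t : Fin 0, m t) * pauliL1 O := by
          rw [Fin.prod_univ_zero, mul_one, pauliL1, Finset.mul_sum, Finset.mul_sum]
          exact Finset.sum_congr rfl fun S _ => by ring
  | succ d ih =>
    intro U ρ O c m hρ hm
    have hc : 0 ≤ c := (norm_nonneg _).trans (hρ fun _ => Pauli.I)
    have hm0 : ∀ t, 0 ≤ m t := fun t => (pauliL1_nonneg _).trans (hm t fun _ => Pauli.I)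
    have hinner : ∀ T : ι → Pauli,
        pathL1Mass (fun i : Fin d => U i.castSucc) ρ ((U (Fin.last d))ᴴ * pauliString T * U (Fin.last d)) ≤
          c * (∏ t : Fin d, m t.castSucc) * m (Fin.last d) := by
      intro T
      have h := ih (fun i : Fin d => U i.castSucc) ρ ((U (Fin.last d))ᴴ * pauliString T * U (Fin.last d)) c
        (fun t => m t.castSucc) hρ (fun t T' => hm t.castSucc T')
      exact h.trans (mul_le_mul_of_nonneg_left (pauliL1_conj_le (hm (Fin.last d)) |>.trans
        (by rw [pauliL1_pauliString, mul_one])) (mul_nonneg hc (Finset.prod_nonneg fun t _ => hm0 _)))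
    unfold pathL1Mass at hinner ⊢
    rw [sum_fin_snoc]
    calc ∑ T : ι → Pauli, ∑ s' : Fin (d + 1) → ι → Pauli, ‖pathCoeff 0 U ρ O (Fin.snoc s' T)‖
        = ∑ T : ι → Pauli, ((2 : ℝ) ^ Fintype.card ι)⁻¹ * ‖(O * pauliString T).trace‖ *
            ∑ s' : Fin (d + 1) → ι → Pauli, ‖pathCoeff 0 (fun i : Fin d => U i.castSucc) ρ
              ((U (Fin.last d))ᴴ * pauliString T * U (Fin.last d)) s'‖ := by
          refine Finset.sum_congr rfl fun T _ => ?_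
          rw [Finset.mul_sum]
          refine Finset.sum_congr rfl fun s' _ => ?_
          rw [pathCoeff_snoc, depolarizeAll_rate_zero, norm_mul, norm_mul, norm_inv, norm_pow, Complex.norm_ofNat]
      _ ≤ ∑ T : ι → Pauli, ((2 : ℝ) ^ Fintype.card ι)⁻¹ * ‖(O * pauliString T).trace‖ *
            (c * (∏ t : Fin d, m t.castSucc) * m (Fin.last d)) :=
          Finset.sum_le_sum fun T _ => mul_le_mul_of_nonneg_left (hinner T) (by positivity)
      _ = c * (∏ t : Fin (d + 1), m t) * pauliL1 O := by
          rw [Fin.prod_univ_castSucc, pauliL1, Finset.mul_sum, Finset.mul_sum]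
          exact Finset.sum_congr rfl fun T _ => by ring

/-- (R2, record) **Path-ℓ₁ budget**: bounded input brackets and per-layer expansions `m_t` give
`Λ ≤ c · (Π_t m_t) · ‖O‖_{P,1}` — for a Clifford circuit with `t` Pauli rotations, `Λ ≤ c · 2^{t/2} · ‖O‖_{P,1}`
whatever the depth, geometry or qubit number (path-sum form of Rall et al.'s cost bound).
[cite: RallEtAl2019, §2.2 (bound after Def. 2.2)] [cite: GonzalezGarciaCiracTrivedi2025PauliPathBeyondAverageQuantum, proof of Theorem 1 (count N_w ≤ 2^{Qw}; here the ℓ₁ mass)] -/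
def PathL1Budget : Prop :=
  ∀ {ι : Type} [Fintype ι] [DecidableEq ι] {d : ℕ} (U : Fin d → Matrix (ι → Bool) (ι → Bool) ℂ)
    (ρ O : Matrix (ι → Bool) (ι → Bool) ℂ) (c : ℝ) (m : Fin d → ℝ)
    (_hρ : ∀ S : ι → Pauli, ‖(pauliString S * ρ).trace‖ ≤ c)
    (_hm : ∀ (t : Fin d) (T : ι → Pauli), pauliL1 ((U t)ᴴ * pauliString T * U t) ≤ m t),
    pathL1Mass U ρ O ≤ c * (∏ t, m t) * pauliL1 O

/-- R2 holds. [cite: RallEtAl2019, §2.2] [cite: GonzalezGarciaCiracTrivedi2025PauliPathBeyondAverageQuantum, proof of Theorem 1] -/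
theorem pathL1Budget_holds : PathL1Budget := fun U ρ O c m hρ hm => pathL1Mass_le_budget _ U ρ O c m hρ hm

/-- `PathL1Budget` — `_holds` alias of `pathL1Budget_holds` above under the fact's exact name (appended
2026-08-28, D-0026 bookkeeping: the proof term is the existing theorem of this file; no statement,
definition or attribute is edited; no new named fact; the ledger's debt table listed the fact
unproved). [cite: GonzalezGarciaCiracTrivedi2025PauliPathBeyondAverageQuantum, proof of Theorem 1] -/
theorem _root_.Literature.Computability.QuantumComplexity.PauliPathL1Mass.PathL1Budget_holds :
    PathL1Budget :=
  _root_.Literature.Computability.QuantumComplexity.PauliPathL1Mass.pathL1Budget_holds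

/-- (R2′) Basis-state input and a Pauli observable (`c = 1`, `‖P‖_{P,1} = 1`): `Λ ≤ Π_t m_t`.
[cite: GonzalezGarciaCiracTrivedi2025PauliPathBeyondAverageQuantum, §3 (computational-basis input, Pauli observable)] -/
theorem pathL1Mass_proj_pauli_le {d : ℕ} (U : Fin d → Matrix (ι → Bool) (ι → Bool) ℂ) (y : ι → Bool)
    (P : ι → Pauli) (m : Fin d → ℝ)
    (hm : ∀ (t : Fin d) (T : ι → Pauli), pauliL1 ((U t)ᴴ * pauliString T * U t) ≤ m t) :
    pathL1Mass U (proj y) (pauliString P) ≤ ∏ t, m t := by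
  have h := pathL1Mass_le_budget d U (proj y) (pauliString P) 1 m
    (fun S => norm_trace_pauliString_mul_proj_le_one S y) hm
  rwa [one_mul, pauliL1_pauliString, mul_one] at h

open scoped ComplexOrder in
/-- (R2″) Density-matrix input (`c = 1` by L-06's state bound `PauliPathL2Window.normSq_trace_pauliString_mul_le_one`,
by name): `Λ ≤ (Π_t m_t) · ‖O‖_{P,1}` — GGCT's arbitrary product-state inputs included.
[cite: GonzalezGarciaCiracTrivedi2025PauliPathBeyondAverageQuantum, Theorem 1 (an initial product state ρ_0) and proof (|tr(s_0 ρ_0)| ≤ 1)] -/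
theorem pathL1Mass_state_le {d : ℕ} (U : Fin d → Matrix (ι → Bool) (ι → Bool) ℂ) {ρ : Matrix (ι → Bool) (ι → Bool) ℂ}
    (hρ : ρ.PosSemidef) (hρ1 : ρ.trace = 1) (O : Matrix (ι → Bool) (ι → Bool) ℂ) (m : Fin d → ℝ)
    (hm : ∀ (t : Fin d) (T : ι → Pauli), pauliL1 ((U t)ᴴ * pauliString T * U t) ≤ m t) :
    pathL1Mass U ρ O ≤ (∏ t, m t) * pauliL1 O := by
  have h := pathL1Mass_le_budget d U ρ O 1 m (fun S => (sq_le_one_iff₀ (norm_nonneg _)).1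
    (PauliPathL2Window.normSq_trace_pauliString_mul_le_one hρ hρ1 S)) hm
  rwa [one_mul] at h

/-! ### §5 Window W — weight truncation is worst-case accurate on bounded path-ℓ₁ mass, at every rate -/

/-- **The magic-budget window** (R1 + R2): at EVERY real rate `0 ≤ γ ≤ 1` and every cut-off `ℓ`,
`|⟨O⟩_err − ⟨O⟩_ℓ| ≤ (1−γ)^{ℓ+1} · c · (Π_t m_t) · ‖O‖_{P,1}` — the worst-case (fixed circuit, input, observable)
guarantee for Hamming-weight truncation on the class "path-ℓ₁ mass ≤ M", with no threshold on `γ`.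
[cite: GonzalezGarciaCiracTrivedi2025PauliPathBeyondAverageQuantum, Theorem 1 (worst-case guarantee for magic-depth-sparse circuits above a noise threshold: here no threshold, the ℓ₁ budget instead)] -/
theorem norm_noisyValue_sub_truncValue_le_budget (γ : ℝ) (hγ0 : 0 ≤ γ) (hγ1 : γ ≤ 1) (ℓ : ℕ) {d : ℕ}
    (U : Fin d → Matrix (ι → Bool) (ι → Bool) ℂ) (ρ O : Matrix (ι → Bool) (ι → Bool) ℂ) (c : ℝ) (m : Fin d → ℝ)
    (hρ : ∀ S : ι → Pauli, ‖(pauliString S * ρ).trace‖ ≤ c)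
    (hm : ∀ (t : Fin d) (T : ι → Pauli), pauliL1 ((U t)ᴴ * pauliString T * U t) ≤ m t) :
    ‖noisyValue (γ : ℂ) U ρ O - truncValue (γ : ℂ) ℓ U ρ O‖ ≤ (1 - γ) ^ (ℓ + 1) * (c * (∏ t, m t) * pauliL1 O) :=
  (norm_noisyValue_sub_truncValue_le_tailL1Mass γ hγ0 hγ1 ℓ U ρ O).trans
    (mul_le_mul_of_nonneg_left ((tailL1Mass_le_pathL1Mass ℓ U ρ O).trans (pathL1Mass_le_budget d U ρ O c m hρ hm))
      (pow_nonneg (by linarith) _))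

/-- (W, record) **Magic-budget window**. [cite: GonzalezGarciaCiracTrivedi2025PauliPathBeyondAverageQuantum, Theorem 1] -/
def MagicBudgetWindow : Prop :=
  ∀ {ι : Type} [Fintype ι] [DecidableEq ι] (γ : ℝ) (_hγ0 : 0 ≤ γ) (_hγ1 : γ ≤ 1) (ℓ : ℕ) {d : ℕ}
    (U : Fin d → Matrix (ι → Bool) (ι → Bool) ℂ) (ρ O : Matrix (ι → Bool) (ι → Bool) ℂ) (c : ℝ) (m : Fin d → ℝ)
    (_hρ : ∀ S : ι → Pauli, ‖(pauliString S * ρ).trace‖ ≤ c)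
    (_hm : ∀ (t : Fin d) (T : ι → Pauli), pauliL1 ((U t)ᴴ * pauliString T * U t) ≤ m t),
    ‖noisyValue (γ : ℂ) U ρ O - truncValue (γ : ℂ) ℓ U ρ O‖ ≤ (1 - γ) ^ (ℓ + 1) * (c * (∏ t, m t) * pauliL1 O)

/-- W holds. [cite: GonzalezGarciaCiracTrivedi2025PauliPathBeyondAverageQuantum, Theorem 1] -/
theorem magicBudgetWindow_holds : MagicBudgetWindow := fun γ hγ0 hγ1 ℓ _ U ρ O c m hρ hm =>
  norm_noisyValue_sub_truncValue_le_budget γ hγ0 hγ1 ℓ U ρ O c m hρ hm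

/-- `MagicBudgetWindow` — `_holds` alias of `magicBudgetWindow_holds` above under the fact's exact name (appended
2026-08-28, D-0026 bookkeeping: the proof term is the existing theorem of this file; no statement,
definition or attribute is edited; no new named fact; the ledger's debt table listed the fact
unproved). [cite: GonzalezGarciaCiracTrivedi2025PauliPathBeyondAverageQuantum, Theorem 1] -/
theorem _root_.Literature.Computability.QuantumComplexity.PauliPathL1Mass.MagicBudgetWindow_holds :
    MagicBudgetWindow :=
  _root_.Literature.Computability.QuantumComplexity.PauliPathL1Mass.magicBudgetWindow_holds

/-! ### §6 Record R4 — necessity: the barrier's witnesses carry exponential path-ℓ₁ mass (the lens object) -/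

/-- **Necessity of tail mass**: an instance whose weight-`ℓ` truncation error at rate `γ < 1` is at least `E` has
`Λ_{>ℓ} ≥ E / (1−γ)^{ℓ+1}` (contrapositive of R1): every witness of `pauliPathTruncation_worstCase`-type (error bounded
below, cut-off `ℓ`, rate `γ`) carries path-ℓ₁ mass exponential in `γ (ℓ+1)` ("competition between magic and noise").
[cite: GonzalezGarciaCiracTrivedi2025PauliPathBeyondAverageQuantum, §7 Conclusion (competition between quantum magic and the noise)] -/
theorem tailL1Mass_ge_of_error_ge (γ : ℝ) (hγ0 : 0 ≤ γ) (hγ1 : γ < 1) (ℓ : ℕ) {d : ℕ}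
    (U : Fin d → Matrix (ι → Bool) (ι → Bool) ℂ) (ρ O : Matrix (ι → Bool) (ι → Bool) ℂ) (E : ℝ)
    (hE : E ≤ ‖noisyValue (γ : ℂ) U ρ O - truncValue (γ : ℂ) ℓ U ρ O‖) :
    E / (1 - γ) ^ (ℓ + 1) ≤ tailL1Mass ℓ U ρ O := by
  rw [div_le_iff₀ (pow_pos (by linarith) _), mul_comm]
  exact hE.trans (norm_noisyValue_sub_truncValue_le_tailL1Mass γ hγ0 hγ1.le ℓ U ρ O)

/-- **Necessity of expansion (magic) budget**: under the hypotheses of R2 with `c ‖O‖_{P,1} > 0`, an error `≥ E` at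
`(γ, ℓ)` forces `Π_t m_t ≥ E / ((1−γ)^{ℓ+1} c ‖O‖_{P,1})` — Clifford layers contribute factor `1`, so the error
lower bound is paid for entirely by the non-Clifford layers' Pauli-1-norm expansion.
[cite: GonzalezGarciaCiracTrivedi2025PauliPathBeyondAverageQuantum, §7 Conclusion and Theorem 3 (the witness is Clifford + T)] -/
theorem prod_expansion_ge_of_error_ge (γ : ℝ) (hγ0 : 0 ≤ γ) (hγ1 : γ < 1) (ℓ : ℕ) {d : ℕ}
    (U : Fin d → Matrix (ι → Bool) (ι → Bool) ℂ) (ρ O : Matrix (ι → Bool) (ι → Bool) ℂ) (c : ℝ) (m : Fin d → ℝ)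
    (hρ : ∀ S : ι → Pauli, ‖(pauliString S * ρ).trace‖ ≤ c)
    (hm : ∀ (t : Fin d) (T : ι → Pauli), pauliL1 ((U t)ᴴ * pauliString T * U t) ≤ m t)
    (hpos : 0 < c * pauliL1 O) (E : ℝ)
    (hE : E ≤ ‖noisyValue (γ : ℂ) U ρ O - truncValue (γ : ℂ) ℓ U ρ O‖) :
    E / ((1 - γ) ^ (ℓ + 1) * (c * pauliL1 O)) ≤ ∏ t, m t := by
  have hpow : 0 < (1 - γ) ^ (ℓ + 1) := pow_pos (by linarith) _
  rw [div_le_iff₀ (mul_pos hpow hpos)]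
  calc E ≤ (1 - γ) ^ (ℓ + 1) * (c * (∏ t, m t) * pauliL1 O) :=
        hE.trans (norm_noisyValue_sub_truncValue_le_budget γ hγ0 hγ1.le ℓ U ρ O c m hρ hm)
    _ = (∏ t, m t) * ((1 - γ) ^ (ℓ + 1) * (c * pauliL1 O)) := by ring

/-- (R4, record) **Witnesses need mass**: the two necessity inequalities, for every real `0 ≤ γ < 1`.
[cite: GonzalezGarciaCiracTrivedi2025PauliPathBeyondAverageQuantum, §7 Conclusion (competition between quantum magic and the noise)] -/
def WitnessNeedsMass : Prop :=
  ∀ {ι : Type} [Fintype ι] [DecidableEq ι] (γ : ℝ) (_hγ0 : 0 ≤ γ) (_hγ1 : γ < 1) (ℓ : ℕ) {d : ℕ}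
    (U : Fin d → Matrix (ι → Bool) (ι → Bool) ℂ) (ρ O : Matrix (ι → Bool) (ι → Bool) ℂ) (E : ℝ)
    (_hE : E ≤ ‖noisyValue (γ : ℂ) U ρ O - truncValue (γ : ℂ) ℓ U ρ O‖),
    E / (1 - γ) ^ (ℓ + 1) ≤ tailL1Mass ℓ U ρ O ∧
      ∀ (c : ℝ) (m : Fin d → ℝ) (_hρ : ∀ S : ι → Pauli, ‖(pauliString S * ρ).trace‖ ≤ c)
        (_hm : ∀ (t : Fin d) (T : ι → Pauli), pauliL1 ((U t)ᴴ * pauliString T * U t) ≤ m t)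
        (_hpos : 0 < c * pauliL1 O), E / ((1 - γ) ^ (ℓ + 1) * (c * pauliL1 O)) ≤ ∏ t, m t

/-- R4 holds. [cite: GonzalezGarciaCiracTrivedi2025PauliPathBeyondAverageQuantum, §7 Conclusion] -/
theorem witnessNeedsMass_holds : WitnessNeedsMass := fun γ hγ0 hγ1 ℓ _ U ρ O E hE =>
  ⟨tailL1Mass_ge_of_error_ge γ hγ0 hγ1 ℓ U ρ O E hE, fun c m hρ hm hpos =>
    prod_expansion_ge_of_error_ge γ hγ0 hγ1 ℓ U ρ O c m hρ hm hpos E hE⟩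

/-- `WitnessNeedsMass` — `_holds` alias of `witnessNeedsMass_holds` above under the fact's exact name (appended
2026-08-28, D-0026 bookkeeping: the proof term is the existing theorem of this file; no statement,
definition or attribute is edited; no new named fact; the ledger's debt table listed the fact
unproved). [cite: GonzalezGarciaCiracTrivedi2025PauliPathBeyondAverageQuantum, §7 Conclusion] -/
theorem _root_.Literature.Computability.QuantumComplexity.PauliPathL1Mass.WitnessNeedsMass_holds :
    WitnessNeedsMass :=
  _root_.Literature.Computability.QuantumComplexity.PauliPathL1Mass.witnessNeedsMass_holds

/-! ### §7 Record R5 — the catalogued witness, read in the ℓ₁ currency (from the barrier theorem by name) -/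

open Literature.Barriers.QuantumAdvantage in
/-- **GGCT's witness carries exponential tail mass**: for `0 ≤ p < 1 − √(2/3)` and `2k < ℓ ≤ 9k/4`,
`Λ_{>ℓ}(C_k, ρ_k, Z^{(1)}) ≥ (((3/2)(1−p)²)^k − 1) / (1−p)^{ℓ+1}` — the catalogued lower bound
`pauliPathTruncation_worstCase_holds` fed into R4; no block recomputation.
[cite: GonzalezGarciaCiracTrivedi2025PauliPathBeyondAverageQuantum, Lemma 6 (v) and Theorem 3] -/
theorem ggct_witness_tailL1Mass_ge (p : ℝ) (hp0 : 0 ≤ p) (hp : p < 1 - Real.sqrt (2 / 3)) (k ℓ : ℕ)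
    (hkℓ : 2 * k < ℓ) (hℓk : 4 * ℓ ≤ 9 * k) :
    ((3 / 2 * (1 - p) ^ 2) ^ k - 1) / (1 - p) ^ (ℓ + 1) ≤
      tailL1Mass ℓ (GGCT.layers k) (GGCT.input k) (pauliString (GGCT.obs k)) := by
  have hp1 : p < 1 := by linarith [Real.sqrt_nonneg (2 / 3 : ℝ)]
  exact tailL1Mass_ge_of_error_ge p hp0 hp1 ℓ (GGCT.layers k) (GGCT.input k) (pauliString (GGCT.obs k)) _
    (pauliPathTruncation_worstCase_holds p hp0 hp k ℓ hkℓ hℓk)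

open Literature.Barriers.QuantumAdvantage in
/-- **Noiseless corollary**: the witness circuit `C_k` (`k` T-gate blocks) has path-ℓ₁ mass `Λ ≥ (3/2)^k − 1` for
every `k ≥ 4` (take `p = 0`, `ℓ = 2k + 1`).  The count currency only says `N ≤ 4^k` paths of modulus `≤ 1`.
[cite: GonzalezGarciaCiracTrivedi2025PauliPathBeyondAverageQuantum, Lemma 6 (iv)–(v) (Tr(O_C) = (3/2)^k)] -/
theorem ggct_witness_pathL1Mass_ge (k : ℕ) (hk : 4 ≤ k) :
    (3 / 2 : ℝ) ^ k - 1 ≤ pathL1Mass (GGCT.layers k) (GGCT.input k) (pauliString (GGCT.obs k)) := by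
  have hs : (0 : ℝ) < 1 - Real.sqrt (2 / 3) := by
    have : Real.sqrt (2 / 3) < 1 := (Real.sqrt_lt' one_pos).2 (by norm_num)
    linarith
  have h := ggct_witness_tailL1Mass_ge 0 le_rfl hs k (2 * k + 1) (by omega) (by omega)
  simp only [sub_zero, one_pow, mul_one, div_one] at h
  exact h.trans (tailL1Mass_le_pathL1Mass _ _ _ _)

open Literature.Barriers.QuantumAdvantage in
/-- (R5, record) **The catalogued witness in the ℓ₁ currency**. [cite: GonzalezGarciaCiracTrivedi2025PauliPathBeyondAverageQuantum, Lemma 6 (v) and Theorem 3] -/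
def GGCTWitnessMass : Prop :=
  (∀ (p : ℝ) (_hp0 : 0 ≤ p) (_hp : p < 1 - Real.sqrt (2 / 3)) (k ℓ : ℕ) (_hkℓ : 2 * k < ℓ) (_hℓk : 4 * ℓ ≤ 9 * k),
      ((3 / 2 * (1 - p) ^ 2) ^ k - 1) / (1 - p) ^ (ℓ + 1) ≤
        tailL1Mass ℓ (GGCT.layers k) (GGCT.input k) (pauliString (GGCT.obs k))) ∧
    ∀ (k : ℕ) (_hk : 4 ≤ k), (3 / 2 : ℝ) ^ k - 1 ≤ pathL1Mass (GGCT.layers k) (GGCT.input k) (pauliString (GGCT.obs k))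

/-- R5 holds. [cite: GonzalezGarciaCiracTrivedi2025PauliPathBeyondAverageQuantum, Lemma 6 (v) and Theorem 3] -/
theorem ggctWitnessMass_holds : GGCTWitnessMass :=
  ⟨fun p hp0 hp k ℓ hkℓ hℓk => ggct_witness_tailL1Mass_ge p hp0 hp k ℓ hkℓ hℓk,
    fun k hk => ggct_witness_pathL1Mass_ge k hk⟩

/-- `GGCTWitnessMass` — `_holds` alias of `ggctWitnessMass_holds` above
(appended 2026-08-28, D-0026 bookkeeping: the proof term is the existing theorem of this file;
no statement, definition or attribute is edited; no new named fact).
[cite: GonzalezGarciaCiracTrivedi2025PauliPathBeyondAverageQuantum, Lemma 6 (v) and Theorem 3] -/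
theorem _root_.Literature.Computability.QuantumComplexity.PauliPathL1Mass.GGCTWitnessMass_holds :
    GGCTWitnessMass :=
  ggctWitnessMass_holds

/-! ### §8 Numbers (record) -/

/-- **Numbers**: (a) at `γ = 1/10`, a mass budget `c · Π m_t · ‖O‖_{P,1} ≤ 2^{10}` (e.g. twenty `T`-type rotations)
and `ℓ = 199` give error `≤ (9/10)^{200} · 2^{10} < 10^{-6}`; (b) on the catalogued witness at `p = 1/10`, `k = 40`
(so `ℓ ∈ (80, 90]`): tail mass `≥ ((3/2)(81/100))^{40} − 1 > 2400` already before dividing by `(9/10)^{ℓ+1}`;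
(c) `√2^{2} = 2`: two T-type rotations cost at most a factor `2`.
[cite: GonzalezGarciaCiracTrivedi2025PauliPathBeyondAverageQuantum, Theorem 3 (numbers instantiated)] -/
theorem truncationL1Mass_numbers :
    (9 / 10 : ℝ) ^ 200 * 2 ^ 10 < 10⁻¹ ^ 6 ∧ (2400 : ℝ) < (3 / 2 * (1 - 1 / 10) ^ 2) ^ 40 - 1 ∧
      Real.sqrt 2 ^ 2 = 2 := by
  refine ⟨by norm_num, by norm_num, ?_⟩
  rw [Real.sq_sqrt (by norm_num)]

/-! ### §9 Target -/

/-- **Target of the line** `truncation-l1-mass-necessity`: R1 ∧ R2 ∧ R3 ∧ W ∧ R4 ∧ R5.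
[cite: GonzalezGarciaCiracTrivedi2025PauliPathBeyondAverageQuantum, Theorem 1, Lemma 6 (v), Theorem 3 and §7] -/
def PauliPathL1MassTarget : Prop :=
  L1MassTail ∧ PathL1Budget ∧ CliffordLayersFree ∧ MagicBudgetWindow ∧ WitnessNeedsMass ∧ GGCTWitnessMass

/-- The target holds. [cite: GonzalezGarciaCiracTrivedi2025PauliPathBeyondAverageQuantum, Theorem 1, Lemma 6 (v), Theorem 3 and §7] -/
theorem pauliPathL1MassTarget_holds : PauliPathL1MassTarget :=
  ⟨l1MassTail_holds, pathL1Budget_holds, cliffordLayersFree_holds, magicBudgetWindow_holds,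
    witnessNeedsMass_holds, ggctWitnessMass_holds⟩

/-- `PauliPathL1MassTarget` — `_holds` alias of `pauliPathL1MassTarget_holds` above under the fact's exact name (appended
2026-08-28, D-0026 bookkeeping: the proof term is the existing theorem of this file; no statement,
definition or attribute is edited; no new named fact; the ledger's debt table listed the fact
unproved). [cite: GonzalezGarciaCiracTrivedi2025PauliPathBeyondAverageQuantum, Theorem 1, Lemma 6 (v), Theorem 3 and §7] -/
theorem _root_.Literature.Computability.QuantumComplexity.PauliPathL1Mass.PauliPathL1MassTarget_holds :
    PauliPathL1MassTarget :=
  _root_.Literature.Computability.QuantumComplexity.PauliPathL1Mass.pauliPathL1MassTarget_holds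

end PauliPathL1Mass

end Literature.Computability.QuantumComplexity
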